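import Literature.NumberTheory.Automorphic.SymplecticSiegelParabolic
import Literature.NumberTheory.Automorphic.SymplecticSatakeTransform
import Literature.NumberTheory.Automorphic.ValuedFieldValuativeRelBridge
import Literature.NumberTheory.Automorphic.SatakeIsomorphismGLNormalisations
import Literature.NumberTheory.Automorphic.HeckePairCongruenceSubgroups
import HarnessLib

/-!
# The Siegel descent of the Satake transform of `Sp_{2n}` to its Levi `GL_n(K)` and the `S_n`-INVARIANCE of the Satake
# transform of `ℋ(Sp_{2n}(K), Sp_{2n}(𝒪); R)` in every rank (Cartier 1979 §IV, proof of Thm. 4.1 (b); Satake 1963 §7)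

Topic `NumberTheory/Automorphic`; namespace `Literature.NumberTheory.Automorphic.SymplecticCartan` (lane `lit-hodgefound`,
Track 2 foundations; seat `lit-hodgefound-p11`, generation 50, row g50-#2).  ONE DEFINITION with body
(`siegelCosetGL`) + theorems; no named fact, no instance, no notation.  The `Sp_{2n}` analogue of
`HyperspecialUnitarySatakeSiegelDescent` (g48-#3), for Mathlib's `symplecticGroup (Fin n) K` and the tree's Iwasawa datum
`(B(K), Sp(J, 𝒪), a)` (`SymplecticGroupIwasawa`, `SymplecticGroupIwasawaExponents`, `SymplecticSatakeTransform`).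

## The mathematics

`G = Sp(J, K)` (`K` a field with `Valued K ℤᵐ⁰`, uniformiser `ϖ`), `K₀ = Sp(J, 𝒪)`, `P_S = {(A 0; C D)} ⊇ B(K)` the Siegel
parabolic with Levi projection `q ↦ D(q) ∈ GL_n(K)` (`SymplecticSiegelParabolic`).  Every coset `γ ∈ G/K₀` has a Borel
representative `b_γ` (Iwasawa decomposition), and `Φ(γ) := D(b_γ) GL_n(𝒪)` is a well-defined map `G/K₀ → GL_n(K)/GL_n(𝒪)`
(two representatives in `P_S` differ by an element of `K₀ ∩ P_S`, whose `D`-block is integral with integral inverse),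
equivariant for `K₀ ∩ P_S` acting through `D`.  The Iwasawa exponents are compatible: **`a(γ) = -a_{GL}(Φ γ)`**
(`a(γ)ᵢ = ord (b_γ)_{inl i, inl i}` and `D(b_γ)` is upper triangular with `v(D(b_γ)_{ii}) = exp(a(γ)ᵢ)`).  Hence for every weight
`w` and every `T ∈ ℋ_R(G, K₀)` — Cartier's transitivity `S^G = S^M ∘ r^G_M` along `P_S = M N` —

  `𝒮^G_w(T) = (-)_* ( satakeVec_{GL_n} (w ∘ (-)) (Φ_* T[K₀]) )`,

the push-forward `Φ_* T[K₀] ∈ R[GL_n(K)/GL_n(𝒪)]` being `GL_n(𝒪)`-invariant (every `k' ∈ GL_n(𝒪)` lifts to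
`m(k') = (ᵗk'⁻¹ 0; 0 k') ∈ K₀ ∩ P_S`), i.e. `Φ_* T[K₀] = T'[GL_n(𝒪)]` for a Hecke operator `T' ∈ ℋ_R(GL_n(K), GL_n(𝒪))`.  In
Cartier's normalisation `w = q^{⟨ρ, ·⟩}`, `ρ = (n, …, 1)` (`symplecticSatakeWeight`), the weight `w ∘ (-) = q^{-⟨ν, ·⟩} · q^{-|·|}`
(`ν = (n-1, …, 0)`) is the INTEGRAL `GL_n` weight times the `S_n`-invariant character `q^{-|·|}`; by the tree's Satake theorem
for `GL_n(K)` over any commutative ring in which `q` is a unit (`satakeTransformModP_mem_weylInvariants`, g42) and the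
stability of `R[ℤⁿ]^{S_n}` under `S_n`-invariant twists, the transform of `T'` is `S_n`-symmetric; therefore
**`𝒮_q(T)_{μ ∘ τ} = 𝒮_q(T)_μ` for every permutation `τ` of the coordinates** — the `S_n`-part of the Weyl group
`W(C_n) = (ℤ/2)^n ⋊ S_n` of `Sp_{2n}`.  (The sign changes: `w₀ = -1` is the tree's `coeff_symplecticSatakeTransform_neg`,
`SymplecticBorelModulusIndex`; the remaining ones come from the Klingen descent of the sequel.)  No square root of `q` is
needed: `Sp_{2n}` is simply connected, `ρ` is integral.

## What is formalised

* §1 `borelRep_mem_symplecticSiegelParabolic` (the Borel representative `b_γ` of `SymplecticSiegelParabolic` lies in `P_S`).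
* §2 (`K` with a compatible `ValuativeRel`) `siegelBlockGL_mem_glInt`, **`siegelCosetGL`** `Φ : G/K₀ → GL_n(K)/GL_n(𝒪)`,
  **`siegelCosetGL_mk`** (well defined on `P_S`-representatives), **`siegelCosetGL_smul`** (`K₀ ∩ P_S`-equivariance),
  **`symplecticIwasawaExp_out_eq_neg_iwasawaExp`** (`a(γ) = -a_{GL}(Φ γ)`).
* §3 **`satakeTransform_eq_mapDomain_neg_siegelCosetGL`** (THE DESCENT IDENTITY, every weight, every `R`),
  `ofMulAction_mapDomain_siegelCosetGL`, **`mapDomain_siegelCosetGL_toVector_invariant`** (`Φ_* T[K₀]` is `GL_n(𝒪)`-invariant).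
* §4 `exists_monoidHom_apply_ofAdd_eq_zpow_neg_sum` (the character `q^{-|·|}`, `S_n`-invariant),
  `symplecticSatakeWeight_ofAdd_neg_eq` (`q^{⟨ρ,-e⟩} = q^{-|e|} · q^{-⟨ν,e⟩}`),
  **`satakeVec_mapDomain_siegelCosetGL_mem_weylInvariants`**, **`coeff_symplecticSatakeTransform_comp_perm`**
  (`𝒮_q(T)_{μ ∘ τ} = 𝒮_q(T)_μ`, every `τ ∈ S_n`, every commutative `R` with `(q : R) = #𝓀` a unit), and the `Valued`-only
  restatement **`coeff_symplecticSatakeTransform_comp_perm_of_valued`** (the auxiliary `ValuativeRel` structure is built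
  inside the proof from `Valued.v`).

## References
* [CartierCorvallis1979] P. Cartier, *Representations of 𝔭-adic groups: a survey*, PSPM 33.1 (1979), §IV (4.2), Thm. 4.1 and its
  proof (b) (the image of `S` is `W`-invariant: reduction to the Levi subgroups of the maximal parabolics).
* [Satake1963] I. Satake, *Theory of spherical functions on reductive algebraic groups over 𝔭-adic fields*, Publ. Math. IHÉS 18
  (1963), §7 (the symplectic group), §8.3.
* [AndrianovZhuravlev1995] A. N. Andrianov, V. G. Zhuravlev, *Modular Forms and Hecke Operators*, Transl. Math. Monogr. 145
  (1995), Ch. 3 §3.3 (3.44)–(3.49) (the spherical map `Ω` through triangular representatives), Thm. 3.30.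
* [BruhatTits1972] F. Bruhat, J. Tits, *Groupes réductifs sur un corps local I*, Publ. Math. IHÉS 41 (1972), (4.4.3).
* [Macdonald1995] I. G. Macdonald, *Symmetric Functions and Hall Polynomials*, 2nd ed. (1995), Ch. V (2.6)–(2.9), (3.4).
-/

noncomputable section

open scoped Valued WithZero Matrix MatrixGroups
open Matrix MonoidAlgebra Representation

namespace Literature.NumberTheory.Automorphic.SymplecticCartan

open Literature.NumberTheory.Automorphic Literature.NumberTheory.Automorphic.CartanUnique
  Literature.NumberTheory.Automorphic.HermitianLattice

variable {K : Type*} [Field K] [Valued K ℤᵐ⁰] {ϖ : K} {n : ℕ}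

/-! ## §1 Borel representatives in the Siegel parabolic -/

/-- The Borel representative as an element of the Siegel parabolic. [cite: AndrianovZhuravlev1995, Ch. 1 §3 Prop. 3.7] -/
theorem borelRep_mem_symplecticSiegelParabolic (hϖ : Valued.v ϖ = WithZero.exp (-1 : ℤ))
    (γ : symplecticGroup (Fin n) K ⧸ symplecticInt (Fin n) K) : borelRep hϖ γ ∈ symplecticSiegelParabolic n K :=
  symplecticBorel_le_symplecticSiegelParabolic (borelRep_mem hϖ γ)

/-! ## §2 The Siegel coset map `Φ : Sp(J, K)/Sp(J, 𝒪) → GL_n(K)/GL_n(𝒪)` -/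

section Coset

variable [ValuativeRel K] [(Valued.v : Valuation K ℤᵐ⁰).Compatible]

/-- The `D`-block of an element of `Sp(J, 𝒪) ∩ P_S` lies in `GL_n(𝒪)`. [cite: CartierCorvallis1979, §IV.1] [cite: BruhatTits1972, (4.4.3)] -/
theorem siegelBlockGL_mem_glInt {q : symplecticSiegelParabolic n K} (hq : (q : symplecticGroup (Fin n) K) ∈ symplecticInt (Fin n) K) :
    siegelBlockGL n K q ∈ glInt n K :=
  (mem_glInt_iff_forall_v_le_one _).2 (v_siegelBlockGL_le_one hq)

/-- **The Siegel coset map** `Φ(γ) = D(b_γ) GL_n(𝒪)`: the `(inr, inr)` block of a Borel representative, read in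
`GL_n(K)/GL_n(𝒪)`. [cite: CartierCorvallis1979, §IV (4.2)] [cite: Satake1963, §7] -/
def siegelCosetGL (hϖ : Valued.v ϖ = WithZero.exp (-1 : ℤ)) (γ : symplecticGroup (Fin n) K ⧸ symplecticInt (Fin n) K) :
    GL (Fin n) K ⧸ glInt n K :=
  ↑(siegelBlockGL n K ⟨borelRep hϖ γ, borelRep_mem_symplecticSiegelParabolic hϖ γ⟩)

omit [(Valued.v : Valuation K ℤᵐ⁰).Compatible] in
/-- Unfolding `Φ`. [cite: CartierCorvallis1979, §IV (4.2)] -/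
theorem siegelCosetGL_eq (hϖ : Valued.v ϖ = WithZero.exp (-1 : ℤ)) (γ : symplecticGroup (Fin n) K ⧸ symplecticInt (Fin n) K) :
    siegelCosetGL hϖ γ = ↑(siegelBlockGL n K ⟨borelRep hϖ γ, borelRep_mem_symplecticSiegelParabolic hϖ γ⟩) := rfl

/-- **`Φ` is well defined on representatives in `P_S`**: `Φ(q K₀) = D(q) GL_n(𝒪)` for every `q ∈ P_S`.
[cite: CartierCorvallis1979, §IV (4.2)] -/
theorem siegelCosetGL_mk (hϖ : Valued.v ϖ = WithZero.exp (-1 : ℤ)) {q : symplecticGroup (Fin n) K}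
    (hq : q ∈ symplecticSiegelParabolic n K) :
    siegelCosetGL hϖ (q : symplecticGroup (Fin n) K ⧸ symplecticInt (Fin n) K) = ↑(siegelBlockGL n K ⟨q, hq⟩) := by
  rw [siegelCosetGL_eq]
  refine QuotientGroup.eq.2 ?_
  rw [← map_inv, ← map_mul]
  refine siegelBlockGL_mem_glInt ?_
  change (borelRep hϖ _)⁻¹ * q ∈ symplecticInt (Fin n) K
  exact QuotientGroup.eq.1 (mk_borelRep hϖ _)

/-- **`Φ` is `K₀ ∩ P_S`-equivariant** (indeed `P_S`-equivariant): `Φ(k γ) = D(k) Φ(γ)`. [cite: CartierCorvallis1979, §IV (4.2)] -/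
theorem siegelCosetGL_smul (hϖ : Valued.v ϖ = WithZero.exp (-1 : ℤ)) {k : symplecticGroup (Fin n) K}
    (hk : k ∈ symplecticSiegelParabolic n K) (γ : symplecticGroup (Fin n) K ⧸ symplecticInt (Fin n) K) :
    siegelCosetGL hϖ (k • γ) = (siegelBlockGL n K ⟨k, hk⟩ : GL (Fin n) K) • siegelCosetGL hϖ γ := by
  conv_lhs => rw [← mk_borelRep hϖ γ]
  rw [MulAction.Quotient.smul_coe, smul_eq_mul,
    siegelCosetGL_mk hϖ ((symplecticSiegelParabolic n K).mul_mem hk (borelRep_mem_symplecticSiegelParabolic hϖ γ)), siegelCosetGL_eq,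
    MulAction.Quotient.smul_coe, smul_eq_mul, ← map_mul]
  rfl

/-- **Compatibility of the Iwasawa exponents: `a(γ) = -a_{GL}(Φ γ)`** — the exponents of a coset of `Sp(J, K)` are minus the
`GL_n` exponents of its image (both are read off the diagonal of the Borel representative: `v((b_γ)_{inl i, inl i}) = exp(-a(γ)ᵢ)`,
`v(D(b_γ)_{ii}) = exp(a(γ)ᵢ)`). [cite: CartierCorvallis1979, §IV (4.2)] [cite: BruhatTits1972, (4.4.3)] -/
theorem symplecticIwasawaExp_out_eq_neg_iwasawaExp (hϖ : Valued.v ϖ = WithZero.exp (-1 : ℤ))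
    [IsDiscreteValuationRing (ValuativeRel.valuation K).integer] (hϖ' : IsUniformizingElement ϖ)
    (γ : symplecticGroup (Fin n) K ⧸ symplecticInt (Fin n) K) :
    symplecticIwasawaExp hϖ γ.out = -Literature.NumberTheory.Automorphic.iwasawaExp hϖ' (siegelCosetGL hϖ γ).out := by
  rw [symplecticIwasawaExp_out_eq_borelRep, siegelCosetGL_eq, Literature.NumberTheory.Automorphic.iwasawaExp_out_coe,
    iwasawaExp_eq_of_forall_v_apply_self_eq hϖ' hϖ (blockTriangular_siegelBlockGL_of_mem_symplecticBorel (borelRep_mem hϖ γ))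
      (a := -symplecticIwasawaExp hϖ (borelRep hϖ γ)) fun i => ?_, neg_neg]
  rw [Pi.neg_apply, neg_neg]
  exact v_siegelBlockGL_apply_self hϖ (borelRep_mem hϖ γ) i

end Coset

/-! ## §3 The descent identity and the invariance of the pushed-forward vector -/

section Descent

variable [ValuativeRel K] [(Valued.v : Valuation K ℤᵐ⁰).Compatible] {R : Type*} [CommRing R]

/-- **THE SIEGEL DESCENT IDENTITY** (Cartier's `S^G = S^M ∘ r^G_M` for the Siegel parabolic of `Sp_{2n}`): for every weight `w`
and every `T ∈ ℋ_R(Sp(J, K), Sp(J, 𝒪))`,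
`𝒮^G_w(T) = (-)_* ( satakeVec_{GL_n} (w ∘ (-)) (Φ_* T[K₀]) )` — the Satake transform of `T` is the push-forward along `μ ↦ -μ`
of the `GL_n` transform, with weight `w ∘ (-)`, of the push-forward of `T[K₀]` along `Φ`. [cite: CartierCorvallis1979, §IV (4.2), Thm. 4.1]
[cite: Satake1963, §7] -/
theorem satakeTransform_eq_mapDomain_neg_siegelCosetGL (hϖ : Valued.v ϖ = WithZero.exp (-1 : ℤ))
    [IsDiscreteValuationRing (ValuativeRel.valuation K).integer] (hϖ' : IsUniformizingElement ϖ)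
    (w : Multiplicative (Fin n → ℤ) →* R) (T : heckeAlgebra R (symplecticGroup (Fin n) K) (symplecticInt (Fin n) K)) :
    (isIwasawaExponent_symplectic hϖ).satakeTransform w T =
      AddMonoidAlgebra.mapDomain (fun μ : Fin n → ℤ => -μ)
        (IsIwasawaExponent.satakeVec (glInt n K) (Literature.NumberTheory.Automorphic.iwasawaExp hϖ')
          (w.comp (AddMonoidHom.toMultiplicative (-(AddMonoidHom.id (Fin n → ℤ)))))
          (MonoidAlgebra.mapDomain (siegelCosetGL hϖ) (heckeAlgebra.toVector (symplecticInt (Fin n) K) T))) := by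
  rw [IsIwasawaExponent.satakeTransform_apply]
  induction heckeAlgebra.toVector (symplecticInt (Fin n) K) T using MonoidAlgebra.induction_linear with
  | zero => simp only [map_zero, MonoidAlgebra.mapDomain_zero, AddMonoidAlgebra.mapDomain_zero]
  | add x y hx hy => rw [map_add, MonoidAlgebra.mapDomain_add, map_add, AddMonoidAlgebra.mapDomain_add, hx, hy]
  | single γ r =>
    rw [MonoidAlgebra.mapDomain_single, IsIwasawaExponent.satakeVec_single, IsIwasawaExponent.satakeVec_single,
      AddMonoidAlgebra.mapDomain_single, symplecticIwasawaExp_out_eq_neg_iwasawaExp hϖ hϖ']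
    rfl

/-- The push-forward along `Φ` intertwines `k ∈ P_S` with `D(k) ∈ GL_n(K)`. [cite: CartierCorvallis1979, §IV (4.2)] -/
theorem ofMulAction_mapDomain_siegelCosetGL (hϖ : Valued.v ϖ = WithZero.exp (-1 : ℤ)) {k : symplecticGroup (Fin n) K}
    (hk : k ∈ symplecticSiegelParabolic n K)
    (x : MonoidAlgebra R (symplecticGroup (Fin n) K ⧸ symplecticInt (Fin n) K)) :
    ofMulAction R (GL (Fin n) K) (GL (Fin n) K ⧸ glInt n K) (siegelBlockGL n K ⟨k, hk⟩ : GL (Fin n) K)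
        (MonoidAlgebra.mapDomain (siegelCosetGL hϖ) x) =
      MonoidAlgebra.mapDomain (siegelCosetGL hϖ)
        (ofMulAction R (symplecticGroup (Fin n) K) (symplecticGroup (Fin n) K ⧸ symplecticInt (Fin n) K) k x) := by
  induction x using MonoidAlgebra.induction_linear with
  | zero => simp only [map_zero, MonoidAlgebra.mapDomain_zero]
  | add x y hx hy => rw [MonoidAlgebra.mapDomain_add, map_add, map_add, MonoidAlgebra.mapDomain_add, hx, hy]
  | single γ r => rw [MonoidAlgebra.mapDomain_single, ofMulAction_single, ofMulAction_single, MonoidAlgebra.mapDomain_single,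
      siegelCosetGL_smul hϖ hk]

/-- **The push-forward `Φ_* T[K₀]` is `GL_n(𝒪)`-invariant**: every `k' ∈ GL_n(𝒪)` lifts to `m(k') = (ᵗk'⁻¹ 0; 0 k') ∈ K₀ ∩ P_S`,
which fixes `T[K₀]`. [cite: CartierCorvallis1979, §IV (4.2)] [cite: BruhatTits1972, (4.4.3)] -/
theorem mapDomain_siegelCosetGL_toVector_invariant (hϖ : Valued.v ϖ = WithZero.exp (-1 : ℤ))
    (T : heckeAlgebra R (symplecticGroup (Fin n) K) (symplecticInt (Fin n) K)) (k' : GL (Fin n) K) (hk' : k' ∈ glInt n K) :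
    ofMulAction R (GL (Fin n) K) (GL (Fin n) K ⧸ glInt n K) k'
        (MonoidAlgebra.mapDomain (siegelCosetGL hϖ) (heckeAlgebra.toVector (symplecticInt (Fin n) K) T)) =
      MonoidAlgebra.mapDomain (siegelCosetGL hϖ) (heckeAlgebra.toVector (symplecticInt (Fin n) K) T) := by
  obtain ⟨hk1, hk2⟩ := (mem_glInt_iff_forall_v_le_one k').1 hk'
  have hK : siegelLeviLift n K k' ∈ symplecticInt (Fin n) K := siegelLeviLift_mem_symplecticInt hk1 hk2
  rw [← siegelBlockGL_siegelLeviLift (K := K) k', ofMulAction_mapDomain_siegelCosetGL hϖ (siegelLeviLift_mem_symplecticSiegelParabolic k'),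
    heckeAlgebra.ofMulAction_toVector _ T hK]

end Descent

/-! ## §4 `S_n`-invariance of the Satake transform of `Sp_{2n}` -/

section Invariance

variable {R : Type*} [CommRing R]

/-- Coefficients of a push-forward along an injective map of exponent lattices: `(f_* F)_{f μ} = F_μ`. [folklore] -/
private theorem coeff_mapDomain_of_injective {X Y : Type*} {f : X → Y} (hf : Function.Injective f) (F : AddMonoidAlgebra R X)
    (μ : X) : (AddMonoidAlgebra.mapDomain f F).coeff (f μ) = F.coeff μ := by
  rw [AddMonoidAlgebra.mapDomain, AddMonoidAlgebra.coeff_ofCoeff, Finsupp.mapDomain_apply hf]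

/-- An `S_n`-invariant of `R[ℤⁿ]` has `S_n`-symmetric coefficients. [cite: CartierCorvallis1979, §IV.2 Example] -/
theorem coeff_comp_perm_of_mem_weylInvariants_gl {F : AddMonoidAlgebra R (Fin n → ℤ)}
    (hF : F ∈ weylInvariants R (Fin n → ℤ) (ConnectedReductiveGroupData.glWeylGroup n)) (τ : Equiv.Perm (Fin n)) (μ : Fin n → ℤ) :
    F.coeff (μ ∘ τ) = F.coeff μ := by
  rw [mem_weylInvariants_glWeylGroup_iff] at hF
  have h := (domCongr_eq_self_iff_coeff _ _).1 (hF τ) μ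
  rw [SymmLaurent.funCongrLeft_toAddEquiv_apply] at h
  exact h

/-- The character `e ↦ q^{-m|e|}` of `ℤⁿ` exists as a homomorphism and is `S_n`-invariant. [cite: GrossSatake1998, §3] -/
theorem exists_monoidHom_apply_ofAdd_eq_zpow_neg_sum (u : Rˣ) (m : ℤ) :
    ∃ c : Multiplicative (Fin n → ℤ) →* R, (∀ e : Fin n → ℤ, c (Multiplicative.ofAdd e) = ((u ^ (-(m * ∑ i, e i)) : Rˣ) : R)) ∧
      ∀ (e : Fin n → ℤ) (τ : Equiv.Perm (Fin n)), c (Multiplicative.ofAdd (e ∘ τ)) = c (Multiplicative.ofAdd e) := by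
  obtain ⟨c, hc⟩ := exists_monoidHom_apply_ofAdd_eq_units_zpow (Λ := Fin n → ℤ) u
    (-(AddMonoidHom.mk' (fun e : Fin n → ℤ => m * ∑ i, e i) fun a b => by
      simp only [Pi.add_apply, Finset.sum_add_distrib, mul_add]))
  refine ⟨c, fun e => by rw [hc]; rfl, fun e τ => ?_⟩
  rw [hc, hc]
  simp only [AddMonoidHom.neg_apply, AddMonoidHom.mk'_apply]
  rw [show (∑ i, (e ∘ τ) i) = ∑ i, e i from Equiv.sum_comp τ e]

/-- **The weight bookkeeping `⟨ρ, -e⟩ = -|e| - ⟨ν, e⟩`** (`ρ = (n, …, 1)`, `ν = (n-1, …, 0)`): Cartier's `Sp_{2n}` weight read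
through the Siegel Levi is the integral `GL_n` weight times `q^{-|·|}`. [cite: CartierCorvallis1979, §IV (4.2)] [cite: Satake1963, §7] -/
theorem symplecticRhoPairing_neg_eq (e : Fin n → ℤ) :
    symplecticRhoPairing (-e) = -(1 * ∑ i, e i) + -satakeTwistExp e := by
  rw [symplecticRhoPairing, satakeTwistExp, one_mul, ← Finset.sum_neg_distrib, ← Finset.sum_neg_distrib, ← Finset.sum_add_distrib]
  refine Finset.sum_congr rfl fun i _ => ?_
  rw [Pi.neg_apply]
  ring

variable [ValuativeRel K] [(Valued.v : Valuation K ℤᵐ⁰).Compatible]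

/-- **The `GL_n` transform of the pushed-forward vector is `S_n`-invariant**: with `(q : R) = #𝓀` a unit and `w = q^{⟨ρ, ·⟩}`,
the weight `w ∘ (-)` is `q^{-|·|}` times the integral weight `q^{-⟨ν, ·⟩}` of `GL_n`, so the transform of `T' = (Φ_* T[K₀])^♯`
lies in `R[ℤⁿ]^{S_n}` by the Satake theorem for `GL_n(K)` (`satakeTransformModP_mem_weylInvariants`) and the stability of
`R[ℤⁿ]^{S_n}` under `S_n`-invariant twists. [cite: CartierCorvallis1979, §IV Thm. 4.1, §IV.2] [cite: Satake1963, §7] -/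
theorem satakeVec_mapDomain_siegelCosetGL_mem_weylInvariants (hϖ : Valued.v ϖ = WithZero.exp (-1 : ℤ)) [Finite 𝓀[K]]
    [IsDiscreteValuationRing (ValuativeRel.valuation K).integer] (hϖ' : IsUniformizingElement ϖ) (q : Rˣ)
    (hq : (q : R) = Nat.card 𝓀[K]) (T : heckeAlgebra R (symplecticGroup (Fin n) K) (symplecticInt (Fin n) K)) :
    IsIwasawaExponent.satakeVec (glInt n K) (Literature.NumberTheory.Automorphic.iwasawaExp hϖ')
        ((symplecticSatakeWeight q).comp (AddMonoidHom.toMultiplicative (-(AddMonoidHom.id (Fin n → ℤ)))))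
        (MonoidAlgebra.mapDomain (siegelCosetGL hϖ) (heckeAlgebra.toVector (symplecticInt (Fin n) K) T)) ∈
      weylInvariants R (Fin n → ℤ) (ConnectedReductiveGroupData.glWeylGroup n) := by
  haveI : Finite (IsLocalRing.ResidueField (ValuativeRel.valuation K).integer) := finite_residueField_of_compatible
  haveI := isHeckeTriple_glInt_of_finite_residueField (F := K) n
  -- the Hecke operator `T'` of `GL_n` with `T'[GL_n(𝒪)] = Φ_* T[K₀]`
  set v' := MonoidAlgebra.mapDomain (siegelCosetGL hϖ) (heckeAlgebra.toVector (symplecticInt (Fin n) K) T) with hv'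
  set T' : heckeAlgebra R (GL (Fin n) K) (glInt n K) :=
    heckeAlgebra.ofVector (glInt n K) v' (fun k' hk' => mapDomain_siegelCosetGL_toVector_invariant hϖ T k' hk') with hT'
  have hTv : heckeAlgebra.toVector (glInt n K) T' = v' := heckeAlgebra.toVector_ofVector _ _ _
  -- `q` is the unit `#𝓀` of the `ValuativeRel` residue field
  have hqu : IsUnit ((Nat.card (IsLocalRing.ResidueField (ValuativeRel.valuation K).integer) : ℕ) : R) := by
    rw [natCard_residueField_eq_of_compatible, ← hq]; exact Units.isUnit q
  have hunit : hqu.unit = q := Units.ext (by rw [IsUnit.unit_spec, natCard_residueField_eq_of_compatible, hq])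
  -- the weights: `w ∘ (-) = c · w_ν` with `c(e) = q^{-|e|}`, `w_ν(e) = q^{-⟨ν, e⟩}`
  obtain ⟨wν, hwν⟩ := exists_monoidHom_apply_ofAdd_eq_units_zpow (Λ := Fin n → ℤ) q
    (-(AddMonoidHom.mk' (fun e : Fin n → ℤ => satakeTwistExp e) fun a b => satakeTwistExp_add a b))
  obtain ⟨c, hc, hcτ⟩ := exists_monoidHom_apply_ofAdd_eq_zpow_neg_sum (n := n) q 1
  have hwν' : ∀ e : Fin n → ℤ, wν (Multiplicative.ofAdd e) = ((satakeWeightUnit hqu.unit e : Rˣ) : R) := fun e => by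
    rw [hwν, satakeWeightUnit, hunit]; rfl
  have hweights : (symplecticSatakeWeight q).comp (AddMonoidHom.toMultiplicative (-(AddMonoidHom.id (Fin n → ℤ)))) = c * wν := by
    refine MonoidHom.ext fun l => ?_
    have hl : l = Multiplicative.ofAdd (Multiplicative.toAdd l) := rfl
    rw [hl]
    set e := Multiplicative.toAdd l
    rw [MonoidHom.comp_apply, MonoidHom.mul_apply, hc, hwν, ← Units.val_mul, ← _root_.zpow_add]
    change symplecticSatakeWeight q (Multiplicative.ofAdd (-e)) = _
    rw [symplecticSatakeWeight_ofAdd, symplecticRhoPairing_neg_eq]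
    rfl
  have hmain := satakeTransformModP_mem_weylInvariants (n := n) hϖ' hqu T'
  rw [satakeTransformModP_eq_monomialTwist_satakeTransform_one hϖ' hqu hwν', IsIwasawaExponent.satakeTransform_apply, hTv,
    monomialTwist_satakeVec] at hmain
  rw [hweights, ← monomialTwist_satakeVec, ← monomialTwist_comp, AlgHom.comp_apply, monomialTwist_satakeVec]
  exact monomialTwist_mem_weylInvariants c hcτ hmain

/-- **THE `S_n`-INVARIANCE OF THE SATAKE TRANSFORM OF `Sp_{2n}`, EVERY `n`, EVERY COMMUTATIVE COEFFICIENT RING** in which the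
residue cardinality is a unit `q`: for every `T ∈ ℋ_R(Sp(J, K), Sp(J, 𝒪))`, every permutation `τ` of the coordinates and every
`μ ∈ ℤⁿ`, `𝒮_q(T)_{μ ∘ τ} = 𝒮_q(T)_μ` (the subgroup `S_n` of the Weyl group `W(C_n) = (ℤ/2)^n ⋊ S_n`; `K` carries a compatible
`ValuativeRel`, cf. `coeff_symplecticSatakeTransform_comp_perm_of_valued`). [cite: CartierCorvallis1979, §IV Thm. 4.1 and its proof (b)]
[cite: Satake1963, §7] [cite: AndrianovZhuravlev1995, Ch. 3 §3.3 Thm. 3.30] -/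
theorem coeff_symplecticSatakeTransform_comp_perm (hϖ : Valued.v ϖ = WithZero.exp (-1 : ℤ)) [Finite 𝓀[K]] (q : Rˣ)
    (hq : (q : R) = Nat.card 𝓀[K]) (T : heckeAlgebra R (symplecticGroup (Fin n) K) (symplecticInt (Fin n) K))
    (τ : Equiv.Perm (Fin n)) (μ : Fin n → ℤ) :
    (symplecticSatakeTransform hϖ q T).coeff (μ ∘ τ) = (symplecticSatakeTransform hϖ q T).coeff μ := by
  haveI := isDiscreteValuationRing_integer_of_compatible (K := K) hϖ
  have hϖ' : IsUniformizingElement ϖ := isUniformizingElement_of_v_eq hϖ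
  rw [symplecticSatakeTransform_eq, satakeTransform_eq_mapDomain_neg_siegelCosetGL hϖ hϖ']
  set F := IsIwasawaExponent.satakeVec (glInt n K) (Literature.NumberTheory.Automorphic.iwasawaExp hϖ')
    ((symplecticSatakeWeight q).comp (AddMonoidHom.toMultiplicative (-(AddMonoidHom.id (Fin n → ℤ)))))
    (MonoidAlgebra.mapDomain (siegelCosetGL hϖ) (heckeAlgebra.toVector (symplecticInt (Fin n) K) T)) with hF
  have hFW := satakeVec_mapDomain_siegelCosetGL_mem_weylInvariants hϖ hϖ' q hq T
  rw [← hF] at hFW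
  have hinj : Function.Injective (fun ν : Fin n → ℤ => -ν) := neg_injective
  rw [show μ ∘ τ = -((-μ) ∘ τ) from by funext i; simp, show μ = -(-μ) from (neg_neg μ).symm,
    coeff_mapDomain_of_injective hinj, neg_neg, coeff_mapDomain_of_injective hinj]
  exact coeff_comp_perm_of_mem_weylInvariants_gl hFW τ (-μ)

end Invariance

/-! ## §5 The `Valued`-only statement -/

section ValuedOnly

variable {R : Type*} [CommRing R]

/-- **`S_n`-invariance of `𝒮_q(T)` for `Sp_{2n}` in the `Valued` language** (no `ValuativeRel` hypothesis: the compatible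
valuative relation `ValuativeRel.ofValuation Valued.v` is installed inside the proof). [cite: CartierCorvallis1979, §IV Thm. 4.1 (b)]
[cite: Satake1963, §7] -/
theorem coeff_symplecticSatakeTransform_comp_perm_of_valued (hϖ : Valued.v ϖ = WithZero.exp (-1 : ℤ)) [Finite 𝓀[K]] (q : Rˣ)
    (hq : (q : R) = Nat.card 𝓀[K]) (T : heckeAlgebra R (symplecticGroup (Fin n) K) (symplecticInt (Fin n) K))
    (τ : Equiv.Perm (Fin n)) (μ : Fin n → ℤ) :
    (symplecticSatakeTransform hϖ q T).coeff (μ ∘ τ) = (symplecticSatakeTransform hϖ q T).coeff μ := by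
  letI : ValuativeRel K := ValuativeRel.ofValuation (Valued.v : Valuation K ℤᵐ⁰)
  haveI : (Valued.v : Valuation K ℤᵐ⁰).Compatible := Valuation.Compatible.ofValuation _
  exact coeff_symplecticSatakeTransform_comp_perm hϖ q hq T τ μ

end ValuedOnly

end Literature.NumberTheory.Automorphic.SymplecticCartan

end
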